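import Literature.AnabelianGeometry.AbsoluteAnabelian.AbsTopII.Prop13vInertiaCentraliserReduction
import Literature.AnabelianGeometry.AbsoluteAnabelian.FreeProcyclicStructure
import Mathlib.Topology.Algebra.ClopenNhdofOne
import Mathlib.Topology.Algebra.OpenSubgroup
import Mathlib.GroupTheory.OrderOfElement

/-!
# [AbsTopII] Prop 1.3 (v): the input «(iv) at open subgroups» DERIVED from (iv) at the finite étale coverings

S. Mochizuki, *Topics in Absolute Anabelian Geometry II* [AbsTopII] (bib `MochizukiAbsTopII2013`;
locators = PDF pages of the kurims manuscript `paper:url-585b8d0ad0d9`), §1: Def 1.2 (ii) p. 10,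
Remark 1.2.1 pp. 10–11, Proposition 1.3 (iii)/(iv)/(v) pp. 11–12, proof of (v) p. 16.

Row P13/I-L of the sub-DAG `plan/L4/SUBDAG-AbsTopII-Prop13.md` is the first sentence of the printed
proof of Prop 1.3 (v), p. 16: "it follows from assertion (iv) [i.e., by applying assertion (iv) to
various open subgroups of `Π_H`, `Π_I` — cf. also Remark 1.2.1] that if, for `γ ∈ Π_H`,
`I_v ∩ (γ·I_v·γ⁻¹) ≠ {1}`, then `Π_v = γ·Π_v·γ⁻¹`".  The cell's closers for `DPSCData.Prop13v` (F-0278)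
carry it as a verbatim hypothesis (`hL` in `DPSCData.prop13v_of_inputs`, p425615) or in the equivalent
`Π_𝔾`-internal normal form I-Z "`Z_{Π_𝔾}(x) ⊆ D_v` for `1 ≠ x ∈ I_v`" (`DPSCData.prop13v_of_prop13iii_prop13iv'`,
`Prop13vInertiaCentraliserReduction.lean`, p432051).

This PROOF-ONLY file (no definitions) performs the printed derivation itself, by pure profinite group
theory: I-Z — hence I-L, hence Prop 1.3 (v) as typed — FOLLOWS from the "in particular" clause of
Prop 1.3 (iv) ("`I_v ∩ I_{v'} ≠ {1}` implies `v = v'`", `Π_𝔾`-scope as in `DPSCData.Prop13iv'`) APPLIED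
TO THE DPSC DATA OF THE FINITE ÉTALE COVERINGS of Remark 1.2.1 ("any open subgroup of `Π_H` [equipped
with the induced extension structure] admits a structure of [pro-`Σ`] DPSC-extension for appropriate
construction data that may be derived from the original construction data"), together with two
clauses of the typed rows: `Π_v` is closed, and `I_v` is torsion-free (⟸ "`I_v ≅ Ẑ^Σ`", Prop 1.3 (iii)).

THE COVERING DATA, spelled over `X : DPSCData` without new definitions.  For an open normal subgroup
`N ⊆ Π_H` put `U := N ∩ Π_𝔾` (an open normal subgroup of `Π_𝔾`, the geometric fundamental group of the
covering) and let `J ⊆ N ∩ Π_I` be the inverse image of the covering's inertia subgroup (of finite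
index in `Π_I`; Remark 1.2.2: "any open subgroup of `I` may also serve as the inertia subgroup").  The
vertices of the covering graph `𝔾_N` lying over the vertex `v` of `𝔾` are the classes
`δ·Π_v·U ∈ Π_𝔾/(Π_v·U)` (`δ ∈ Π_𝔾`), the vertex `ṽ_δ := [δ·Π_v·U]` having the verticial subgroup
`Π_{ṽ_δ} = δ·Π_v·δ⁻¹ ∩ U ⊆ U = Π_{𝔾_N}` and hence (Def 1.2 (ii) for the covering) the inertia group
`I_{ṽ_δ} = Z_J(δ·Π_v·δ⁻¹ ∩ U)`.  The "in particular" clause of (iv) for the covering, at the pair of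
vertices `ṽ_1`, `ṽ_δ` over `v`, reads

  (iv-cov)  `Z_J(Π_v ∩ U) ∩ Z_J(δ·Π_v·δ⁻¹ ∩ U) ≠ {1}` ⟹ `ṽ_1 = ṽ_δ`, i.e. `δ ∈ Π_v·U`,

and this is the ONLY form in which (iv) "at open subgroups" enters (hypothesis `hcov` below: for every
open normal `N` SOME finite-index inertia part `J ⊆ N ∩ Π_I` satisfies (iv-cov) for all `v`, `δ`).

THE ARGUMENT (p. 16, made explicit).  Let `1 ≠ x ∈ I_v = Z_{Π_I}(Π_v)` and let `δ ∈ Π_𝔾` commute with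
`x`; we show `δ ∈ Π_v` (so `δ ∈ D_v`).  If not, since `Π_v` is closed there is an open normal `N ⊆ Π_H`
with `δ ∉ Π_v·N` (`ProfiniteGrp.exist_openNormalSubgroup_sub_open_nhds_of_one`); a power `y := x^k`
lies in the finite-index `J` (`Subgroup.exists_pow_mem_of_relIndex_ne_zero`) and `y ≠ 1` as `I_v` is
torsion-free; `y` centralises `Π_v`, and — commuting with `δ` — also `δ·Π_v·δ⁻¹`; so `y` is a nontrivial
element of `I_{ṽ_1} ∩ I_{ṽ_δ}`, whence (iv-cov) gives `δ ∈ Π_v·U ⊆ Π_v·N`, a contradiction.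

Main declarations:
* `mem_of_commute_of_coverings` — the generic profinite-group core;
* `DPSCData.centralizer_inf_PiG_le_vertSub_of_coverings` / `…_le_Dv_of_coverings` — I-Z from (iv-cov);
* `DPSCData.inputL_of_coverings` — the printed `Π_H`-level sentence I-L from I-GR, (iv′).2, (iii).1 and
  (iv-cov);
* `DPSCData.prop13v_of_prop13iii_prop13iv'_of_coverings` — **Prop 1.3 (v) (F-0278)** from the typed
  (iii), (iv′), [CombGC] Prop 1.2 (i)(ii), graphicity, (iv-cov), `Π_v` closed, `I_v` torsion-free and
  infinite; `AbsTopII.DPSCIndexData.prop13v_of_prop_1_3_iii'_prop13iv'_of_coverings` reads "`I_v`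
  infinite" from `Prop_1_3_iii'`, and `…_of_coverings'` also "`I_v` torsion-free" (given `Π_I` closed),
  via `AbsTopII.IsFreeProSigmaCyclic.eq_one_of_isOfFinOrder` — **`Ẑ^Σ` is torsion-free** (structure
  theorem `IsFreeProSigmaCyclic.exists_continuousMulEquiv_padicSigmaProd` of `FreeProcyclicStructure`);
* `DPSCData.centralizer_inf_PiG_le_vertSub_of_coverings'` — the variant with the covering's inertia
  part `J := N ∩ Π_I` (the induced extension structure).
HONEST FRAMING: classical group theory over a typed interface of a refereed, undisputed paper; (iv) for
the coverings is a geometric input and stays a hypothesis (typed ≠ proved); nothing here bears on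
[IUTchIII] Cor 3.12.
-/

open scoped Pointwise

namespace Literature.AnabelianGeometry.AbsoluteAnabelian

universe u

/-! ## Generic profinite group theory -/

section GroupTheory

variable {G : Type u} [Group G]

/-- An element commuting with `δ` and centralising `K` centralises `δ·K·δ⁻¹` ("`y ∈ I_v` commuting with
`δ` lies in the inertia group `Z(δ·Π_v·δ⁻¹)` of the conjugate verticial subgroup", proof of (v) p. 16).
[cite: MochizukiAbsTopII2013, Prop 1.3 (v) p.16] -/
theorem mem_centralizer_conj_smul_of_commute {K : Subgroup G} {x δ : G}
    (hx : x ∈ Subgroup.centralizer (K : Set G)) (hc : Commute δ x) :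
    x ∈ Subgroup.centralizer ((MulAut.conj δ • K : Subgroup G) : Set G) := by
  rw [Subgroup.mem_centralizer_iff] at hx ⊢
  intro m hm
  rw [SetLike.mem_coe, Subgroup.mem_smul_pointwise_iff_exists] at hm
  obtain ⟨k, hk, rfl⟩ := hm
  rw [MulAut.smul_def, MulAut.conj_apply]
  have hk' : k * x = x * k := hx k hk
  have h1 : δ⁻¹ * x = x * δ⁻¹ := hc.inv_left.eq
  calc δ * k * δ⁻¹ * x = δ * k * (δ⁻¹ * x) := by group
    _ = δ * k * (x * δ⁻¹) := by rw [h1]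
    _ = δ * (k * x) * δ⁻¹ := by group
    _ = δ * (x * k) * δ⁻¹ := by rw [hk']
    _ = (δ * x) * k * δ⁻¹ := by group
    _ = (x * δ) * k * δ⁻¹ := by rw [hc.eq]
    _ = x * (δ * k * δ⁻¹) := by group

variable [TopologicalSpace G] [IsTopologicalGroup G] [CompactSpace G] [TotallyDisconnectedSpace G]

/-- In a profinite group an element outside a CLOSED subgroup `P` stays outside `P·N` for some open
normal subgroup `N` (open normal subgroups form a basis of neighbourhoods of `1`; used for "`Π_v` and
`δ·Π_v` give distinct vertices of some finite étale covering", Remark 1.2.1).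
[cite: MochizukiAbsTopII2013, Remark 1.2.1 p.10] -/
theorem exists_openNormalSubgroup_not_mem_mul {P : Subgroup G} (hP : IsClosed (P : Set G)) {δ : G}
    (hδ : δ ∉ P) : ∃ N : OpenNormalSubgroup G, δ ∉ (P : Set G) * (N : Set G) := by
  have hW : IsOpen {g : G | δ * g ∈ (P : Set G)ᶜ} :=
    hP.isOpen_compl.preimage (continuous_const_mul δ)
  obtain ⟨N, hN⟩ := ProfiniteGrp.exist_openNormalSubgroup_sub_open_nhds_of_one hW
    (by simpa only [Set.mem_setOf_eq, mul_one, Set.mem_compl_iff, SetLike.mem_coe] using hδ)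
  refine ⟨N, ?_⟩
  rintro ⟨p, hp, n, hn, hpn⟩
  have hn' : n⁻¹ ∈ (N : Set G) := inv_mem (show n ∈ N from hn)
  have h2 := hN hn'
  simp only [Set.mem_setOf_eq, Set.mem_compl_iff, SetLike.mem_coe] at h2
  apply h2
  rw [← hpn, mul_inv_cancel_right]
  exact hp

/-- **The core of the printed argument for «(iv) at open subgroups»** (proof of Prop 1.3 (v), p. 16,
"by applying assertion (iv) to various open subgroups of `Π_H`, `Π_I` — cf. also Remark 1.2.1"), as
abstract profinite group theory.  Data: a profinite group `G` (`Π_H`) with a normal subgroup `PiG`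
(`Π_𝔾`), a subgroup `PiI` (`Π_I`) and a closed subgroup `P` (`Π_v`).  Hypothesis `hcov`: for every open
normal `N ⊆ G` there is a finite-index part `J ⊆ N ∩ Π_I` such that, for all `δ ∈ Π_𝔾`, a nontrivial
element centralising both `P ∩ U` and `δ·P·δ⁻¹ ∩ U` (`U := N ∩ Π_𝔾`) and lying in `J` forces
`δ ∈ P·U` — the "in particular" clause of (iv) for the covering attached to `N`.  Conclusion: an element
`δ ∈ Π_𝔾` commuting with a non-torsion `x ∈ Z(P) ∩ Π_I` lies in `P`.
[cite: MochizukiAbsTopII2013, Prop 1.3 (v) p.16] -/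
theorem mem_of_commute_of_coverings {P PiG PiI : Subgroup G} [PiG.Normal]
    (hP : IsClosed (P : Set G))
    (hcov : ∀ N : Subgroup G, N.Normal → IsOpen (N : Set G) →
      ∃ J : Subgroup G, J ≤ N ⊓ PiI ∧ J.relIndex PiI ≠ 0 ∧
        ∀ δ ∈ PiG, Subgroup.centralizer ((P ⊓ (N ⊓ PiG) : Subgroup G) : Set G) ⊓ J ⊓
            Subgroup.centralizer ((MulAut.conj δ • P ⊓ (N ⊓ PiG) : Subgroup G) : Set G) ≠ ⊥ →
          δ ∈ P ⊔ (N ⊓ PiG))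
    {x : G} (hxP : x ∈ Subgroup.centralizer (P : Set G)) (hxI : x ∈ PiI) (hx : ¬ IsOfFinOrder x)
    {δ : G} (hδ : δ ∈ PiG) (hc : Commute δ x) : δ ∈ P := by
  by_contra hδP
  obtain ⟨N, hN⟩ := exists_openNormalSubgroup_not_mem_mul hP hδP
  obtain ⟨J, -, hJidx, hJ⟩ := hcov (N : Subgroup G) inferInstance N.isOpen
  -- a nontrivial power of `x` inside the finite-index inertia part `J`
  obtain ⟨k, hk0, -, hxk⟩ := Subgroup.exists_pow_mem_of_relIndex_ne_zero hJidx hxI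
  have hxkJ : x ^ k ∈ J := (Subgroup.mem_inf.mp hxk).1
  have hxk1 : x ^ k ≠ 1 := fun h => hx (isOfFinOrder_iff_pow_eq_one.mpr ⟨k, hk0, h⟩)
  -- it centralises `P ∩ U` and `δ·P·δ⁻¹ ∩ U`
  have hxkP : x ^ k ∈ Subgroup.centralizer (P : Set G) := pow_mem hxP k
  have h1 : x ^ k ∈ Subgroup.centralizer (((P ⊓ ((N : Subgroup G) ⊓ PiG) : Subgroup G)) : Set G) :=
    Subgroup.centralizer_le (SetLike.coe_subset_coe.mpr inf_le_left) hxkP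
  have h2 : x ^ k ∈ Subgroup.centralizer
      ((MulAut.conj δ • P ⊓ ((N : Subgroup G) ⊓ PiG) : Subgroup G) : Set G) :=
    Subgroup.centralizer_le (SetLike.coe_subset_coe.mpr inf_le_left)
      (mem_centralizer_conj_smul_of_commute hxkP (hc.pow_right k))
  have hne : Subgroup.centralizer ((P ⊓ ((N : Subgroup G) ⊓ PiG) : Subgroup G) : Set G) ⊓ J ⊓
      Subgroup.centralizer ((MulAut.conj δ • P ⊓ ((N : Subgroup G) ⊓ PiG) : Subgroup G) : Set G) ≠
        ⊥ := by
    rw [Subgroup.ne_bot_iff_exists_ne_one]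
    exact ⟨⟨x ^ k, Subgroup.mem_inf.mpr ⟨Subgroup.mem_inf.mpr ⟨h1, hxkJ⟩, h2⟩⟩,
      fun h => hxk1 (congrArg Subtype.val h)⟩
  have hmem : δ ∈ ((P ⊔ ((N : Subgroup G) ⊓ PiG) : Subgroup G) : Set G) := hJ δ hδ hne
  rw [Subgroup.mul_normal] at hmem
  have hsub : (((N : Subgroup G) ⊓ PiG : Subgroup G) : Set G) ⊆ (N : Set G) :=
    fun g hg => (Subgroup.mem_inf.mp hg).1
  exact hN (Set.mul_subset_mul_left hsub hmem)

/-- **`Ẑ^Σ` is torsion-free**: a compact Hausdorff totally disconnected group which is free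
pro-`Σ`-cyclic in the intrinsic sense of abc-iut-L4-t6 (`AbsTopII.IsFreeProSigmaCyclic`, "as abstract
profinite groups, `≅ Ẑ^Σ`", Prop 1.3 (i)/(iii) p. 11) has no nontrivial element of finite order —
transported along the structure isomorphism `≅ ∏_{p ∈ Σ} ℤ_p`
(`IsFreeProSigmaCyclic.exists_continuousMulEquiv_padicSigmaProd`), each `ℤ_p` being a domain of
characteristic zero. [cite: MochizukiAbsTopII2013, Prop 1.3 (iii) p.11] -/
theorem AbsTopII.IsFreeProSigmaCyclic.eq_one_of_isOfFinOrder {S : Set ℕ} [T2Space G]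
    (h : AbsTopII.IsFreeProSigmaCyclic S G) {g : G} (hg : IsOfFinOrder g) : g = 1 := by
  obtain ⟨e, -, -, -⟩ := h.exists_continuousMulEquiv_padicSigmaProd
  have hfin : IsOfFinOrder (e g) := e.toMulEquiv.toMonoidHom.isOfFinOrder hg
  obtain ⟨n, hn, hpow⟩ := isOfFinOrder_iff_pow_eq_one.mp hfin
  have h0 : Multiplicative.toAdd (e g) = 0 := by
    have hsm : n • Multiplicative.toAdd (e g) = 0 := by rw [← toAdd_pow, hpow, toAdd_one]
    funext p
    have hp : n • Multiplicative.toAdd (e g) p = 0 := by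
      rw [← Pi.smul_apply, hsm, Pi.zero_apply]
    rw [nsmul_eq_mul, mul_eq_zero] at hp
    rcases hp with hp | hp
    · exact absurd hp (Nat.cast_ne_zero.mpr hn.ne')
    · exact hp
  have h1 : e g = 1 := by
    rw [← ofAdd_toAdd (e g), h0]
    rfl
  exact e.injective (by rw [h1, map_one])

end GroupTheory

/-! ## The DPSC layer: I-Z, I-L and Prop 1.3 (v) from (iv) at the coverings -/

namespace DPSCData

variable (X : DPSCData.{u})

/-- **I-Z from (iv) at the finite étale coverings** (proof of Prop 1.3 (v) p. 16, "by applying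
assertion (iv) to various open subgroups of `Π_H`, `Π_I` — cf. also Remark 1.2.1"): if `Π_v` is closed,
`I_v` is torsion-free, and for every open normal `N ⊆ Π_H` the DPSC data of the corresponding covering
(`Π_{𝔾_N} = U := N ∩ Π_𝔾`, inertia part some finite-index `J ⊆ N ∩ Π_I`, vertices `ṽ_δ = [δ·Π_v·U]` over
`v` with `Π_{ṽ_δ} = δ·Π_v·δ⁻¹ ∩ U`, `I_{ṽ_δ} = Z_J(Π_{ṽ_δ})`) satisfies the "in particular" clause of
(iv) "`I_{ṽ_1} ∩ I_{ṽ_δ} ≠ {1}` implies `ṽ_1 = ṽ_δ`" [i.e. `δ ∈ Π_v·U`], then every element of `Π_𝔾`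
commuting with a nontrivial inertia element `x ∈ I_v` lies in `Π_v`.
[cite: MochizukiAbsTopII2013, Prop 1.3 (v) p.16] -/
theorem centralizer_inf_PiG_le_vertSub_of_coverings
    (hcl : ∀ v : X.Vert, IsClosed (X.vertSub v : Set X.PiH))
    (htf : ∀ (v : X.Vert), ∀ x ∈ X.Iv v, IsOfFinOrder x → x = 1)
    (hcov : ∀ N : Subgroup X.PiH, N.Normal → IsOpen (N : Set X.PiH) →
      ∃ J : Subgroup X.PiH, J ≤ N ⊓ X.PiI ∧ J.relIndex X.PiI ≠ 0 ∧
        ∀ (v : X.Vert), ∀ δ ∈ X.PiG,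
          Subgroup.centralizer ((X.vertSub v ⊓ (N ⊓ X.PiG) : Subgroup X.PiH) : Set X.PiH) ⊓ J ⊓
              Subgroup.centralizer
                ((MulAut.conj δ • X.vertSub v ⊓ (N ⊓ X.PiG) : Subgroup X.PiH) : Set X.PiH) ≠ ⊥ →
            δ ∈ X.vertSub v ⊔ (N ⊓ X.PiG))
    (v : X.Vert) {x : X.PiH} (hx : x ∈ X.Iv v) (hx1 : x ≠ 1) :
    Subgroup.centralizer ({x} : Set X.PiH) ⊓ X.PiG ≤ X.vertSub v := by
  intro δ hδ
  obtain ⟨hδx, hδG⟩ := Subgroup.mem_inf.mp hδ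
  rw [Subgroup.mem_centralizer_singleton_iff] at hδx
  haveI : X.PiG.Normal := X.normal_PiG
  obtain ⟨hxZ, hxI⟩ := Subgroup.mem_inf.mp hx
  refine mem_of_commute_of_coverings (hcl v) (fun N hN hNo => ?_) hxZ hxI
    (fun hfin => hx1 (htf v x hx hfin)) hδG hδx
  obtain ⟨J, h1, h2, h3⟩ := hcov N hN hNo
  exact ⟨J, h1, h2, fun δ hδ => h3 v δ hδ⟩

/-- **I-Z** in the shape consumed by `DPSCData.prop13v_of_prop13iii_prop13iv'` (`Z_{Π_𝔾}(x) ⊆ D_v` for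
`1 ≠ x ∈ I_v`), from (iv) at the finite étale coverings, `Π_v` closed and `I_v` torsion-free
(`Π_v ⊆ N_{Π_H}(Π_v) = D_v`). [cite: MochizukiAbsTopII2013, Prop 1.3 (v) p.16] -/
theorem centralizer_inf_PiG_le_Dv_of_coverings
    (hcl : ∀ v : X.Vert, IsClosed (X.vertSub v : Set X.PiH))
    (htf : ∀ (v : X.Vert), ∀ x ∈ X.Iv v, IsOfFinOrder x → x = 1)
    (hcov : ∀ N : Subgroup X.PiH, N.Normal → IsOpen (N : Set X.PiH) →
      ∃ J : Subgroup X.PiH, J ≤ N ⊓ X.PiI ∧ J.relIndex X.PiI ≠ 0 ∧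
        ∀ (v : X.Vert), ∀ δ ∈ X.PiG,
          Subgroup.centralizer ((X.vertSub v ⊓ (N ⊓ X.PiG) : Subgroup X.PiH) : Set X.PiH) ⊓ J ⊓
              Subgroup.centralizer
                ((MulAut.conj δ • X.vertSub v ⊓ (N ⊓ X.PiG) : Subgroup X.PiH) : Set X.PiH) ≠ ⊥ →
            δ ∈ X.vertSub v ⊔ (N ⊓ X.PiG)) :
    ∀ (v : X.Vert), ∀ x ∈ X.Iv v, x ≠ 1 →
      Subgroup.centralizer ({x} : Set X.PiH) ⊓ X.PiG ≤ X.Dv v :=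
  fun v _ hx hx1 =>
    (X.centralizer_inf_PiG_le_vertSub_of_coverings hcl htf hcov v hx hx1).trans Subgroup.le_normalizer

/-- **Row P13/I-L as printed** — "if, for `γ ∈ Π_H`, `I_v ∩ (γ·I_v·γ⁻¹) ≠ {1}`, then
`Π_v = γ·Π_v·γ⁻¹`" (proof of (v) p. 16) — DERIVED from: graphicity of conjugation on verticial subgroups
(I-GR, Def 1.2 (ii)), the "in particular" clause of (iv) at `Π_𝔾`-scope ((iv′).2) for `𝔾` itself AND
for its finite étale coverings (Remark 1.2.1), `I_v ∩ Π_𝔾 = {1}` ((iii)), `Π_v` closed, `I_v`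
torsion-free. [cite: MochizukiAbsTopII2013, Prop 1.3 (v) p.16] -/
theorem inputL_of_coverings
    (hGRv : ∀ (g : X.PiH) (v : X.Vert), ∃ v' : X.Vert, ∃ γ ∈ X.PiG,
      MulAut.conj g • X.vertSub v = MulAut.conj γ • X.vertSub v')
    (hiv : ∀ (v v' : X.Vert) (γ : X.PiH), γ ∈ X.PiG →
      X.Iv v ⊓ MulAut.conj γ • X.Iv v' ≠ ⊥ → v = v')
    (h3 : ∀ v : X.Vert, X.Iv v ⊓ X.PiG = ⊥)
    (hcl : ∀ v : X.Vert, IsClosed (X.vertSub v : Set X.PiH))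
    (htf : ∀ (v : X.Vert), ∀ x ∈ X.Iv v, IsOfFinOrder x → x = 1)
    (hcov : ∀ N : Subgroup X.PiH, N.Normal → IsOpen (N : Set X.PiH) →
      ∃ J : Subgroup X.PiH, J ≤ N ⊓ X.PiI ∧ J.relIndex X.PiI ≠ 0 ∧
        ∀ (v : X.Vert), ∀ δ ∈ X.PiG,
          Subgroup.centralizer ((X.vertSub v ⊓ (N ⊓ X.PiG) : Subgroup X.PiH) : Set X.PiH) ⊓ J ⊓
              Subgroup.centralizer
                ((MulAut.conj δ • X.vertSub v ⊓ (N ⊓ X.PiG) : Subgroup X.PiH) : Set X.PiH) ≠ ⊥ →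
            δ ∈ X.vertSub v ⊔ (N ⊓ X.PiG)) :
    ∀ (v : X.Vert) (g : X.PiH), X.Iv v ⊓ MulAut.conj g • X.Iv v ≠ ⊥ →
      MulAut.conj g • X.vertSub v = X.vertSub v :=
  X.inputL_of_graphic hGRv hiv
    (X.inputLG_of_centralizer_le_Dv h3 (X.centralizer_inf_PiG_le_Dv_of_coverings hcl htf hcov))

/-- **[AbsTopII] Prop 1.3 (v) (F-0278) with «(iv) at open subgroups» DISCHARGED from (iv) at the
finite étale coverings.**  Hypotheses: the typed rows `DPSCData.Prop13iii` (F-0275) and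
`DPSCData.Prop13iv'` BY NAME; graphicity of conjugation on verticial subgroups (Def 1.2 (ii)); [CombGC]
Prop 1.2 (i) (finite-index form) and (ii) for verticial subgroups; the "in particular" clause of (iv)
for the DPSC data of the coverings attached to the open normal subgroups of `Π_H` (Remark 1.2.1); `Π_v`
closed; `I_v` torsion-free and infinite (both ⟸ "`I_v ≅ Ẑ^Σ`", (iii)).  Conclusion: literally
`DPSCData.Prop13v`. [cite: MochizukiAbsTopII2013, Prop 1.3 (v) p.12] -/
theorem prop13v_of_prop13iii_prop13iv'_of_coverings (hiii : X.Prop13iii) (hiv' : X.Prop13iv')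
    (hGRv : ∀ (g : X.PiH) (v : X.Vert), ∃ v' : X.Vert, ∃ γ ∈ X.PiG,
      MulAut.conj g • X.vertSub v = MulAut.conj γ • X.vertSub v')
    (hDetv : ∀ (v v' : X.Vert) (γ : X.PiH), γ ∈ X.PiG →
      (MulAut.conj γ • X.vertSub v' ⊓ X.vertSub v).relIndex (X.vertSub v) ≠ 0 → v' = v)
    (hCTv : ∀ v : X.Vert, IsCommensurablyTerminal ((X.vertSub v).subgroupOf X.PiG))
    (hcl : ∀ v : X.Vert, IsClosed (X.vertSub v : Set X.PiH))
    (htf : ∀ (v : X.Vert), ∀ x ∈ X.Iv v, IsOfFinOrder x → x = 1)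
    (hcov : ∀ N : Subgroup X.PiH, N.Normal → IsOpen (N : Set X.PiH) →
      ∃ J : Subgroup X.PiH, J ≤ N ⊓ X.PiI ∧ J.relIndex X.PiI ≠ 0 ∧
        ∀ (v : X.Vert), ∀ δ ∈ X.PiG,
          Subgroup.centralizer ((X.vertSub v ⊓ (N ⊓ X.PiG) : Subgroup X.PiH) : Set X.PiH) ⊓ J ⊓
              Subgroup.centralizer
                ((MulAut.conj δ • X.vertSub v ⊓ (N ⊓ X.PiG) : Subgroup X.PiH) : Set X.PiH) ≠ ⊥ →
            δ ∈ X.vertSub v ⊔ (N ⊓ X.PiG))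
    (hinf : ∀ v : X.Vert, Infinite ↥(X.Iv v)) : X.Prop13v :=
  X.prop13v_of_prop13iii_prop13iv' hiii hiv' hGRv hDetv hCTv
    (X.centralizer_inf_PiG_le_Dv_of_coverings hcl htf hcov) hinf

/-- The hypothesis (iv-cov) with the covering's inertia part `J := N ∩ Π_I` — the inverse image of
`I ∩ H'` for the open subgroup `H' ⊆ H` of the covering, i.e. the "induced extension structure" of
Remark 1.2.1 — is a special case (it has finite index in `Π_I` because `N` has finite index in `Π_H`):
I-Z from that form. [cite: MochizukiAbsTopII2013, Remark 1.2.1 p.10] -/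
theorem centralizer_inf_PiG_le_vertSub_of_coverings'
    (hcl : ∀ v : X.Vert, IsClosed (X.vertSub v : Set X.PiH))
    (htf : ∀ (v : X.Vert), ∀ x ∈ X.Iv v, IsOfFinOrder x → x = 1)
    (hcov' : ∀ N : Subgroup X.PiH, N.Normal → IsOpen (N : Set X.PiH) →
        ∀ (v : X.Vert), ∀ δ ∈ X.PiG,
          Subgroup.centralizer ((X.vertSub v ⊓ (N ⊓ X.PiG) : Subgroup X.PiH) : Set X.PiH) ⊓
              (N ⊓ X.PiI) ⊓
              Subgroup.centralizer
                ((MulAut.conj δ • X.vertSub v ⊓ (N ⊓ X.PiG) : Subgroup X.PiH) : Set X.PiH) ≠ ⊥ →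
            δ ∈ X.vertSub v ⊔ (N ⊓ X.PiG))
    (v : X.Vert) {x : X.PiH} (hx : x ∈ X.Iv v) (hx1 : x ≠ 1) :
    Subgroup.centralizer ({x} : Set X.PiH) ⊓ X.PiG ≤ X.vertSub v := by
  refine X.centralizer_inf_PiG_le_vertSub_of_coverings hcl htf (fun N hN hNo => ?_) v hx hx1
  refine ⟨N ⊓ X.PiI, le_rfl, ?_, hcov' N hN hNo⟩
  rw [Subgroup.inf_relIndex_right]
  haveI : Finite (X.PiH ⧸ N) := Subgroup.quotient_finite_of_isOpen N hNo
  exact fun h => Subgroup.index_ne_zero_of_finite (Subgroup.index_eq_zero_of_relIndex_eq_zero h)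

end DPSCData

namespace AbsTopII.DPSCIndexData

variable (X : DPSCIndexData.{u})

/-- **[AbsTopII] Prop 1.3 (v) (F-0278) at `Σ`-indexed DPSC data, «(iv) at open subgroups» discharged
from (iv) at the coverings**, with "`I_v` infinite" read from the typed Prop 1.3 (iii) `Prop_1_3_iii'`
(F-0299: `I_v ≅ Ẑ^Σ`) and `I_v ∩ Π_𝔾 = {1}` from `Prop13iii` (F-0275); remaining inputs: graphicity,
[CombGC] Prop 1.2 (i)(ii), `Prop13iv'`, (iv) at the coverings, `Π_v` closed, `I_v` torsion-free.
[cite: MochizukiAbsTopII2013, Prop 1.3 (v) p.12] -/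
theorem prop13v_of_prop_1_3_iii'_prop13iv'_of_coverings (hiii' : X.Prop_1_3_iii')
    (hiii : X.Prop13iii) (hiv' : X.Prop13iv')
    (hGRv : ∀ (g : X.PiH) (v : X.Vert), ∃ v' : X.Vert, ∃ γ ∈ X.PiG,
      MulAut.conj g • X.vertSub v = MulAut.conj γ • X.vertSub v')
    (hDetv : ∀ (v v' : X.Vert) (γ : X.PiH), γ ∈ X.PiG →
      (MulAut.conj γ • X.vertSub v' ⊓ X.vertSub v).relIndex (X.vertSub v) ≠ 0 → v' = v)
    (hCTv : ∀ v : X.Vert, IsCommensurablyTerminal ((X.vertSub v).subgroupOf X.PiG))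
    (hcl : ∀ v : X.Vert, IsClosed (X.vertSub v : Set X.PiH))
    (htf : ∀ (v : X.Vert), ∀ x ∈ X.Iv v, IsOfFinOrder x → x = 1)
    (hcov : ∀ N : Subgroup X.PiH, N.Normal → IsOpen (N : Set X.PiH) →
      ∃ J : Subgroup X.PiH, J ≤ N ⊓ X.PiI ∧ J.relIndex X.PiI ≠ 0 ∧
        ∀ (v : X.Vert), ∀ δ ∈ X.PiG,
          Subgroup.centralizer ((X.vertSub v ⊓ (N ⊓ X.PiG) : Subgroup X.PiH) : Set X.PiH) ⊓ J ⊓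
              Subgroup.centralizer
                ((MulAut.conj δ • X.vertSub v ⊓ (N ⊓ X.PiG) : Subgroup X.PiH) : Set X.PiH) ≠ ⊥ →
            δ ∈ X.vertSub v ⊔ (N ⊓ X.PiG)) : X.Prop13v :=
  X.toDPSCData.prop13v_of_prop13iii_prop13iv'_of_coverings hiii hiv' hGRv hDetv hCTv hcl htf hcov
    (X.infinite_Iv_of_prop_1_3_iii' hiii')

/-- **`I_v` is torsion-free**, read from the typed Prop 1.3 (iii) ("as abstract profinite groups,
`I_v ≅ Ẑ^Σ`": `Prop_1_3_iii'`, F-0299) when `Π_I` is closed in `Π_H` (the inertia subgroup `I ⊆ H` is a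
closed normal subgroup, Def 1.2 (ii): "a continuous injection of profinite groups with normal image"),
so that `I_v = Z_{Π_I}(Π_v)` is a closed, hence profinite, subgroup.
[cite: MochizukiAbsTopII2013, Prop 1.3 (iii) p.11] -/
theorem eq_one_of_isOfFinOrder_of_prop_1_3_iii' (hiii' : X.Prop_1_3_iii')
    (hIcl : IsClosed (X.PiI : Set X.PiH)) (v : X.Vert) {x : X.PiH} (hx : x ∈ X.Iv v)
    (hfin : IsOfFinOrder x) : x = 1 := by
  have hcl : IsClosed (X.Iv v : Set X.PiH) := by
    change IsClosed (((Subgroup.centralizer (X.vertSub v : Set X.PiH) ⊓ X.PiI : Subgroup X.PiH)) :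
      Set X.PiH)
    rw [Subgroup.coe_inf]
    exact (Set.isClosed_centralizer (X.vertSub v : Set X.PiH)).inter hIcl
  haveI : CompactSpace ↥(X.Iv v) := isCompact_iff_compactSpace.mp hcl.isCompact
  obtain ⟨n, hn, hpow⟩ := isOfFinOrder_iff_pow_eq_one.mp hfin
  have hfin' : IsOfFinOrder (⟨x, hx⟩ : ↥(X.Iv v)) :=
    isOfFinOrder_iff_pow_eq_one.mpr ⟨n, hn, Subtype.ext (by simpa using hpow)⟩
  exact congrArg Subtype.val ((hiii'.1 v).2.eq_one_of_isOfFinOrder hfin')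

/-- **[AbsTopII] Prop 1.3 (v) (F-0278) at `Σ`-indexed DPSC data**, with BOTH "`I_v` infinite" and
"`I_v` torsion-free" read from `Prop_1_3_iii'` (F-0299: `I_v ≅ Ẑ^Σ`; `Π_I` closed); remaining inputs:
graphicity, [CombGC] Prop 1.2 (i)(ii), `Prop13iii`, `Prop13iv'`, (iv) at the coverings (Remark 1.2.1),
`Π_v` closed. [cite: MochizukiAbsTopII2013, Prop 1.3 (v) p.12] -/
theorem prop13v_of_prop_1_3_iii'_prop13iv'_of_coverings' (hiii' : X.Prop_1_3_iii')
    (hiii : X.Prop13iii) (hiv' : X.Prop13iv')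
    (hGRv : ∀ (g : X.PiH) (v : X.Vert), ∃ v' : X.Vert, ∃ γ ∈ X.PiG,
      MulAut.conj g • X.vertSub v = MulAut.conj γ • X.vertSub v')
    (hDetv : ∀ (v v' : X.Vert) (γ : X.PiH), γ ∈ X.PiG →
      (MulAut.conj γ • X.vertSub v' ⊓ X.vertSub v).relIndex (X.vertSub v) ≠ 0 → v' = v)
    (hCTv : ∀ v : X.Vert, IsCommensurablyTerminal ((X.vertSub v).subgroupOf X.PiG))
    (hcl : ∀ v : X.Vert, IsClosed (X.vertSub v : Set X.PiH))
    (hIcl : IsClosed (X.PiI : Set X.PiH))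
    (hcov : ∀ N : Subgroup X.PiH, N.Normal → IsOpen (N : Set X.PiH) →
      ∃ J : Subgroup X.PiH, J ≤ N ⊓ X.PiI ∧ J.relIndex X.PiI ≠ 0 ∧
        ∀ (v : X.Vert), ∀ δ ∈ X.PiG,
          Subgroup.centralizer ((X.vertSub v ⊓ (N ⊓ X.PiG) : Subgroup X.PiH) : Set X.PiH) ⊓ J ⊓
              Subgroup.centralizer
                ((MulAut.conj δ • X.vertSub v ⊓ (N ⊓ X.PiG) : Subgroup X.PiH) : Set X.PiH) ≠ ⊥ →
            δ ∈ X.vertSub v ⊔ (N ⊓ X.PiG)) : X.Prop13v :=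
  X.prop13v_of_prop_1_3_iii'_prop13iv'_of_coverings hiii' hiii hiv' hGRv hDetv hCTv hcl
    (fun v _ hx hfin => X.eq_one_of_isOfFinOrder_of_prop_1_3_iii' hiii' hIcl v hx hfin) hcov

end AbsTopII.DPSCIndexData

end Literature.AnabelianGeometry.AbsoluteAnabelian
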